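import Summits.HodgeConjecture.CorCM.SexticDecicWeilPowersHodgeOfMarkman
import Summits.HodgeConjecture.CorCM.SexticOcticWeilJointTransitive
import Summits.HodgeConjecture.CorCM.DecicWeil23PairHodgeOfMarkman
import HarnessLib

/-!
# COR-CM — the Hodge conjecture for EVERY product of copies of `E`, `T`, `B` over a SEXTIC and a DECIC CM field sharing `k`
# (intrinsic form `⨁_j ![E, T, B] (κ j)`), GIVEN ONLY Markman's fourfold and hyperbolic-sixfold theorems — NO hypothesis on the fields

Cell `pub-hodgecm2` (COR-CM), seat b30 gen 27 (2026-08-23); count-neutral own lane SEXTIC-DECIC, sequel of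
`CorCM/SexticDecicWeilPowersHodgeOfMarkman.lean` (frame form); the degree-`(6,10)` twin of gen 26ʼs `CorCM/SexticOcticWeil{HodgeOfMarkman,
JointTransitive}`.  Theorems only; no definition, no named fact, no `sorry`.  HONEST FRAMING: CONDITIONAL on exactly the two displayed named
facts `Markman2025_weilClasses_algebraic_abelianFourfold` and `Markman2025_weilClasses_algebraic_hyperbolicSixfold` (E. Markman, arXiv:2509.23403
Thm. 1.2; arXiv:2502.03415 Thm 1.5.1 — the latter UNREFEREED); `HC_CM` is NOT asserted and no case of the Hodge conjecture is claimed
unconditionally.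

* §1 `exists_perm_pair_positions` (a `2`-subset of `Fin 5` is moved to `{0, 1}` by a permutation), **`exists_frame_fin₂`** — a frame
  `e : Hom(K₃, ℂ) ≃ Fin 5 × Bool` of a decic CM field reading a type with TWO members over `τ` at the positions `{0, 1}` (gen 22ʼs
  `DecicWeil23Pair.exists_frame₅` renumbered);
* §2 **`hodgeConjectureFor_biproduct_comp_vec_of_markman`** — THE HEADLINE: `k` imaginary quadratic, `K₁ ⊇ i₁(k)` ANY sextic CM field,
  `K₃ ⊇ i₃(k)` ANY decic CM field, `E ⊨ (k; Ψ ∋ τ)`, `T ⊨ (K₁; Φ₁)` a CM threefold with ONE member of `Φ₁` over `τ` (`k`-signature `(1,2)`),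
  `B ⊨ (K₃; Φ₃)` a CM FIVEFOLD with TWO members of `Φ₃` over `τ` (`k`-signature `(2,3)`): the Hodge conjecture for every `⨁_j ![E,T,B](κ j)` =
  every `E^a × T^n × B^m`; `…of_avDominatedBy…` (everything dominated); §3 `…_of_signs` (signatures `(1,2)/(2,1) × (2,3)/(3,2)` via the
  conjugate CM structures, `IsCMTypeRealisation.transport`); §4 **`hodgeConjectureFor_of_avDominatedBy_families_of_markman`** (every
  finite FAMILY of realisations `T_j ⊨ Φ₁`, `B_l ⊨ Φ₃` — all isogenous to `T`, resp. `B` — `× E^a`, everything dominated).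
The Hodge rings contain the Weil classes of the FOURFOLD `T × E`, the SIXFOLD `B × E` and the EIGHTFOLD `T × B̄`; all are algebraic modulo the
two facts.  The group-theoretic input (a realised `5`-cycle of the decic pairs; transitivity on the sextic pairs) is free over every pair of
fields — unlike one decic field with several types (gens 22–24: `2`-transitive quintic part needed).
[cite: Markman2025SurveySecant, Thm. 1.2] [cite: Markman2025SecantWeil, Thm 1.5.1] [cite: Pohlmann1968, Thm 1]
[cite: Shimura1998, §6.2 Thm. 3 and §18.2 Lemma (i)] [cite: MumfordAV1970, §19]

## References
* [Markman2025SurveySecant] E. Markman, arXiv:2509.23403, Thm. 1.2.  [Markman2025SecantWeil] E. Markman, arXiv:2502.03415 (unrefereed),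
  Thm 1.5.1.  [Pohlmann1968] H. Pohlmann, Ann. of Math. 88 (1968), Thm 1.  [Shimura1998] G. Shimura, *Abelian varieties with CM and
  modular functions*, §6.2 Thm. 3, §18.2 Lemma (i).  [MumfordAV1970] D. Mumford, *Abelian Varieties*, §19.
-/

noncomputable section

open CategoryTheory CategoryTheory.Limits NumberField

namespace Summit.HodgeConjecture.CorCM.SexticDecicWeil

open Literature.AlgebraicGeometry Literature.AlgebraicGeometry.Motives Literature.AlgebraicGeometry.HodgeTheory
open Literature.AlgebraicGeometry.ComplexMultiplication (IsCMTypeRealisation)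
open Literature.AlgebraicTopology.SingularHomology
open Summit.HodgeConjecture.CorCM.SexticOcticWeil (soSlots exists_frame_fin card_filter_comp_eq_of_finrank card_filter_cmTypeMap_complexConj)
open Summit.HodgeConjecture.CorCM.DecicWeil23Pair (exists_frame₅ card_filter_symm_true₅ mem_iff_of_reading₅ avDominatedBy_of_cmType_eq)
open Summit.HodgeConjecture.CorCM.Domination (AVDominatedBy)
open Summit.HodgeConjecture.CorCM.AndreRiemann (sumFam avDominatedBy_prod_of_biproduct avDominatedBy_biproduct_reindex)

open scoped Classical

/-! ## §1 A frame of a decic CM field reading a `(2,3)`-type at the positions `{0, 1}` -/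

section Frame

/-- **A `2`-subset of `Fin 5` is moved onto `{0, 1}` by a permutation.** [folklore] -/
theorem exists_perm_pair_positions : ∀ J : Finset (Fin 5), J.card = 2 →
    ∃ g : Equiv.Perm (Fin 5), ∀ a : Fin 5, a ∈ J ↔ (g a = 0 ∨ g a = 1) := by
  intro J hJ
  obtain ⟨p, q, hpq, rfl⟩ := Finset.card_eq_two.1 hJ
  -- `g = swap q' 1 ∘ swap p 0` with `q' = swap p 0 q ≠ 0`
  set q' : Fin 5 := Equiv.swap p 0 q with hq'
  have hq'0 : q' ≠ 0 := by
    intro h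
    rw [hq'] at h
    have h' : q = p := (Equiv.swap p 0).injective (h.trans (Equiv.swap_apply_left p 0).symm)
    exact hpq h'.symm
  refine ⟨Equiv.swap q' 1 * Equiv.swap p 0, fun a => ?_⟩
  have hgp : (Equiv.swap q' 1 * Equiv.swap p 0) p = 0 := by
    rw [Equiv.Perm.mul_apply, Equiv.swap_apply_left, Equiv.swap_apply_of_ne_of_ne hq'0.symm (by decide)]
  have hgq : (Equiv.swap q' 1 * Equiv.swap p 0) q = 1 := by
    rw [Equiv.Perm.mul_apply, ← hq', Equiv.swap_apply_left]
  rw [Finset.mem_insert, Finset.mem_singleton]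
  constructor
  · rintro (rfl | rfl)
    · exact Or.inl hgp
    · exact Or.inr hgq
  · rintro (h | h)
    · exact Or.inl ((Equiv.swap q' 1 * Equiv.swap p 0).injective (h.trans hgp.symm))
    · exact Or.inr ((Equiv.swap q' 1 * Equiv.swap p 0).injective (h.trans hgq.symm))

variable {K : Type} [Field K] [NumberField K] [IsCMField K] {k : Type} [Field k] [NumberField k]

omit [IsCMField K] in
/-- **A FRAME of `Hom(K, ℂ)` reading a type with TWO members over `τ` at the positions `{0, 1}`** (`[K:ℚ] = 10`, `[k:ℚ] = 2`): gen 22ʼs frame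
`exists_frame₅` (`(e s).2 = [s ∘ i = τ]`, `e s̄ = ((e s).1, ¬(e s).2)`) followed by a permutation of `Fin 5` moving the two positions of `Φ`
over `τ` to `0, 1`. [cite: Shimura1998, §18.2 Lemma (i)] -/
theorem exists_frame_fin₂ (h10 : Module.finrank ℚ K = 10) (h2 : Module.finrank ℚ k = 2) (i : k →+* K) {τ : k →+* ℂ}
    (hττ : ComplexEmbedding.conjugate τ ≠ τ) (hk : ∀ σ : k →+* ℂ, σ = τ ∨ σ = ComplexEmbedding.conjugate τ)
    (Φ : CMType K) (h23 : (Finset.univ.filter fun s : K →+* ℂ => s.comp i = τ ∧ s ∈ Φ.1).card = 2) :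
    ∃ e : (K →+* ℂ) ≃ Fin 5 × Bool, (∀ s, (e s).2 = true ↔ s.comp i = τ) ∧
      (∀ s, e (ComplexEmbedding.conjugate s) = ((e s).1, !(e s).2)) ∧ ∀ s, s ∈ Φ.1 ↔ (e s).2 = decide ((e s).1 = 0 ∨ (e s).1 = 1) := by
  obtain ⟨e, he_sign, he_conj⟩ := exists_frame₅ h10 h2 i hττ hk
  set J : Finset (Fin 5) := Finset.univ.filter fun a => e.symm (a, true) ∈ Φ.1 with hJ
  have hJcard : J.card = 2 := by rw [hJ, card_filter_symm_true₅ he_sign (fun s => s ∈ Φ.1)]; exact h23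
  obtain ⟨g, hg⟩ := exists_perm_pair_positions J hJcard
  let e' : (K →+* ℂ) ≃ Fin 5 × Bool := e.trans (Equiv.prodCongr g (Equiv.refl Bool))
  have he' : ∀ s, e' s = (g (e s).1, (e s).2) := fun s => rfl
  have he'_conj : ∀ s, e' (ComplexEmbedding.conjugate s) = ((e' s).1, !(e' s).2) := fun s => by
    rw [he', he', he_conj]
  refine ⟨e', fun s => by rw [he']; exact he_sign s, he'_conj, fun s => ?_⟩
  refine mem_iff_of_reading₅ he'_conj (P := fun a : Fin 5 => decide (a = 0 ∨ a = 1)) (fun a => ?_) s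
  have hsymm : e'.symm (a, true) = e.symm (g.symm a, true) := by
    apply e'.injective
    rw [Equiv.apply_symm_apply, he', Equiv.apply_symm_apply, Equiv.apply_symm_apply]
  have hJmem : g.symm a ∈ J ↔ e.symm (g.symm a, true) ∈ Φ.1 := by
    rw [hJ, Finset.mem_filter]
    simp
  rw [hsymm, decide_eq_true_iff, ← hJmem, hg, Equiv.apply_symm_apply]

end Frame

/-! ## §2 The intrinsic theorem for `⨁_j ![E, T, B] (κ j)` — no hypothesis on the fields -/

section Vec

variable {k K₁ K₃ : Type} [Field k] [NumberField k] [IsCMField k] [Field K₁] [NumberField K₁] [IsCMField K₁]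
  [Field K₃] [NumberField K₃] [IsCMField K₃] {N : ℕ}
  {E T B : AbelianVariety ℂ} {Ψ : CMType k} {Φ₁ : CMType K₁} {Φ₃ : CMType K₃}
  {ιE : 𝓞 k →+* End E} {θE : k →+* Module.End ℂ (complexBetti E.X 1)}
  {ιT : 𝓞 K₁ →+* End T} {θT : K₁ →+* Module.End ℂ (complexBetti T.X 1)}
  {ιB : 𝓞 K₃ →+* End B} {θB : K₃ →+* Module.End ℂ (complexBetti B.X 1)}

/-- **HEADLINE (intrinsic form).  The Hodge conjecture for every product of copies of `E`, `T`, `B` — `E^a × T^n × B^m`, all exponents, any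
order (`⨁_j ![E, T, B] (κ j)`, `κ : Fin N → Fin 3`) — GIVEN ONLY Markman's fourfold and hyperbolic-sixfold theorems, with NO hypothesis on
the fields**: `k` an imaginary quadratic field, `K₁ ⊇ i₁(k)` ANY sextic CM field, `K₃ ⊇ i₃(k)` ANY decic CM field, `E ⊨ (k; Ψ)` a CM elliptic
curve (`τ ∈ Ψ`), `T ⊨ (K₁; Φ₁)` a CM abelian threefold whose type has exactly ONE member over `τ` (`k`-signature `(1,2)`), `B ⊨ (K₃; Φ₃)` a CM
abelian FIVEFOLD whose type has exactly TWO members over `τ` (`k`-signature `(2,3)`).  The Hodge rings contain the Weil classes of the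
FOURFOLD `T × E`, the SIXFOLD `B × E` and the EIGHTFOLD `T × B̄`; all are algebraic modulo the two facts.  `HC_CM` is NOT asserted.
[cite: Markman2025SurveySecant, Thm. 1.2] [cite: Markman2025SecantWeil, Thm 1.5.1] [cite: Pohlmann1968, Thm 1] -/
theorem hodgeConjectureFor_biproduct_comp_vec_of_markman
    (hW4 : Markman2025_weilClasses_algebraic_abelianFourfold) (hM6 : Markman2025_weilClasses_algebraic_hyperbolicSixfold)
    (h2 : Module.finrank ℚ k = 2) (h6 : Module.finrank ℚ K₁ = 6) (h10 : Module.finrank ℚ K₃ = 10) (i₁ : k →+* K₁) (i₃ : k →+* K₃)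
    (hE : IsCMTypeRealisation Ψ E ιE θE) (hT : IsCMTypeRealisation Φ₁ T ιT θT) (hB : IsCMTypeRealisation Φ₃ B ιB θB)
    {τ : k →+* ℂ} (hτΨ : τ ∈ Ψ.1)
    (h12 : (Finset.univ.filter fun s : K₁ →+* ℂ => s.comp i₁ = τ ∧ s ∈ Φ₁.1).card = 1)
    (h23 : (Finset.univ.filter fun t : K₃ →+* ℂ => t.comp i₃ = τ ∧ t ∈ Φ₃.1).card = 2)
    (κ : Fin N → Fin 3) :
    HodgeConjectureFor (⨁ fun j => (![E, T, B] : Fin 3 → AbelianVariety ℂ) (κ j)).dim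
      (⨁ fun j => (![E, T, B] : Fin 3 → AbelianVariety ℂ) (κ j)).X := by
  have hττ : ComplexEmbedding.conjugate τ ≠ τ := QuarticCM.conjugate_ne τ
  have hk : ∀ σ : k →+* ℂ, σ = τ ∨ σ = ComplexEmbedding.conjugate τ := fun σ => QuarticCM.eq_or_eq_conjugate_of_quadratic h2 τ σ
  have hΨ : ∀ σ : k →+* ℂ, σ ∈ Ψ.1 ↔ σ = τ := by
    intro σ
    rcases hk σ with rfl | rfl
    · exact ⟨fun _ => rfl, fun _ => hτΨ⟩
    · exact ⟨fun h => absurd h ((Ψ.2 τ).1 hτΨ), fun h => absurd h hττ⟩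
  obtain ⟨δ₀, d, hd, hδ₀⟩ := CyclicSextic.exists_sq_eq_neg_nat_of_isTotallyComplex k h2
  obtain ⟨δ, hδ, hτ⟩ := OcticCurveFourfold.exists_delta_of_mem h2 hd hδ₀ τ
  -- the two frames
  obtain ⟨e₁, he₁_sign, he₁_conj, hΦ₁⟩ := exists_frame_fin (n := 2) i₁ hττ hk
    (card_filter_comp_eq_of_finrank (n := 3) i₁ h6 h2 τ) Φ₁ h12
  obtain ⟨e₃, he₃_sign, he₃_conj, hΦ₃⟩ := exists_frame_fin₂ h10 h2 i₃ hττ hk Φ₃ h23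
  -- the family of fields `(k, K₁, K₃)` with its instances (all identifications below are definitional)
  let Kf : Fin 3 → Type := Fin.cons k (Fin.cons K₁ (Fin.cons K₃ finZeroElim))
  letI instF : ∀ j, Field (Kf j) := Fin.cons ‹Field k› (Fin.cons ‹Field K₁› (Fin.cons ‹Field K₃› finZeroElim))
  letI instN : ∀ j, NumberField (Kf j) :=
    Fin.cons ‹NumberField k› (Fin.cons ‹NumberField K₁› (Fin.cons ‹NumberField K₃› finZeroElim))
  haveI instC : ∀ j, IsCMField (Kf j) := Fin.cons ‹IsCMField k› (Fin.cons ‹IsCMField K₁› (Fin.cons ‹IsCMField K₃› finZeroElim))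
  -- the data over the three slots `soSlots 0 1 2 = (0, 1, 2)`
  let Φ' : ∀ j : Fin 3, CMType (Kf (soSlots (0 : Fin 3) 1 2 j)) := Fin.cons Ψ (Fin.cons Φ₁ (Fin.cons Φ₃ finZeroElim))
  let ι' : ∀ j : Fin 3, 𝓞 (Kf (soSlots (0 : Fin 3) 1 2 j)) →+* End ((![E, T, B] : Fin 3 → AbelianVariety ℂ) j) :=
    Fin.cons ιE (Fin.cons ιT (Fin.cons ιB finZeroElim))
  let θ' : ∀ j : Fin 3, Kf (soSlots (0 : Fin 3) 1 2 j) →+*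
      Module.End ℂ (complexBetti ((![E, T, B] : Fin 3 → AbelianVariety ℂ) j).X 1) :=
    Fin.cons θE (Fin.cons θT (Fin.cons θB finZeroElim))
  have hA : ∀ j, IsCMTypeRealisation (Φ' j) ((![E, T, B] : Fin 3 → AbelianVariety ℂ) j) (ι' j) (θ' j) :=
    Fin.cons hE (Fin.cons hT (Fin.cons hB finZeroElim))
  exact hodgeConjectureFor_biproduct_comp_of_frames_of_markman (Kf := Kf) (i₀ := (0 : Fin 3)) (i₁ := 1) (i₂ := 2)
    (A := (![E, T, B] : Fin 3 → AbelianVariety ℂ)) (Φ := Φ') (ι := ι') (θ := θ')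
    hW4 hM6 κ h6 h10 h2 i₁ i₃ hd hδ hτ hA e₁ e₃ he₁_sign he₃_sign he₁_conj he₃_conj hΨ hΦ₁ hΦ₃

/-- **Everything dominated by a product of copies of `E`, `T`, `B`** — abelian subvarieties, quotients, isogeny images of the
`E^a × T^n × B^m` — satisfies the Hodge conjecture, GIVEN ONLY Markman's two theorems (no hypothesis on the fields).
[cite: Markman2025SurveySecant, Thm. 1.2] [cite: Markman2025SecantWeil, Thm 1.5.1] [cite: MumfordAV1970, §19] -/
theorem hodgeConjectureFor_of_avDominatedBy_comp_vec_of_markman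
    (hW4 : Markman2025_weilClasses_algebraic_abelianFourfold) (hM6 : Markman2025_weilClasses_algebraic_hyperbolicSixfold)
    (h2 : Module.finrank ℚ k = 2) (h6 : Module.finrank ℚ K₁ = 6) (h10 : Module.finrank ℚ K₃ = 10) (i₁ : k →+* K₁) (i₃ : k →+* K₃)
    (hE : IsCMTypeRealisation Ψ E ιE θE) (hT : IsCMTypeRealisation Φ₁ T ιT θT) (hB : IsCMTypeRealisation Φ₃ B ιB θB)
    {τ : k →+* ℂ} (hτΨ : τ ∈ Ψ.1)
    (h12 : (Finset.univ.filter fun s : K₁ →+* ℂ => s.comp i₁ = τ ∧ s ∈ Φ₁.1).card = 1)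
    (h23 : (Finset.univ.filter fun t : K₃ →+* ℂ => t.comp i₃ = τ ∧ t ∈ Φ₃.1).card = 2)
    (κ : Fin N → Fin 3) {X : AbelianVariety ℂ}
    (hX : Domination.AVDominatedBy X (⨁ fun j => (![E, T, B] : Fin 3 → AbelianVariety ℂ) (κ j))) :
    HodgeConjectureFor X.dim X.X :=
  Domination.hodgeConjectureFor_of_avDominatedBy
    (hodgeConjectureFor_biproduct_comp_vec_of_markman hW4 hM6 h2 h6 h10 i₁ i₃ hE hT hB hτΨ h12 h23 κ) hX

end Vec

/-! ## §3 The conjugate signatures `(2,1)` and `(3,2)`: conjugate CM structures on `T` and on `B` -/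

section Signatures

variable {k K₁ K₃ : Type} [Field k] [NumberField k] [IsCMField k] [Field K₁] [NumberField K₁] [IsCMField K₁]
  [Field K₃] [NumberField K₃] [IsCMField K₃] {N : ℕ}
  {E T B : AbelianVariety ℂ} {Ψ : CMType k} {Φ₁ : CMType K₁} {Φ₃ : CMType K₃}
  {ιE : 𝓞 k →+* End E} {θE : k →+* Module.End ℂ (complexBetti E.X 1)}
  {ιT : 𝓞 K₁ →+* End T} {θT : K₁ →+* Module.End ℂ (complexBetti T.X 1)}
  {ιB : 𝓞 K₃ →+* End B} {θB : K₃ →+* Module.End ℂ (complexBetti B.X 1)}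

/-- **ALL FOUR SIGN COMBINATIONS.**  The headline `hodgeConjectureFor_biproduct_comp_vec_of_markman` with `T` of `k`-signature `(1,2)` OR
`(2,1)` and `B` of `k`-signature `(2,3)` OR `(3,2)`: a structure with `2` (resp. `3`) members over `τ` is replaced by the CONJUGATE CM structure
on the SAME variety (`IsCMTypeRealisation.transport` along complex conjugation of `K₁`, resp. `K₃`), which realises the conjugate type with
`3 − 2 = 1` (resp. `5 − 3 = 2`) members over `τ`; the abelian varieties, hence the conclusion, are unchanged.
[cite: Markman2025SurveySecant, Thm. 1.2] [cite: Markman2025SecantWeil, Thm 1.5.1] [cite: Shimura1998, §18.2 Lemma (i)] -/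
theorem hodgeConjectureFor_biproduct_comp_vec_of_markman_of_signs
    (hW4 : Markman2025_weilClasses_algebraic_abelianFourfold) (hM6 : Markman2025_weilClasses_algebraic_hyperbolicSixfold)
    (h2 : Module.finrank ℚ k = 2) (h6 : Module.finrank ℚ K₁ = 6) (h10 : Module.finrank ℚ K₃ = 10) (i₁ : k →+* K₁) (i₃ : k →+* K₃)
    (hE : IsCMTypeRealisation Ψ E ιE θE) (hT : IsCMTypeRealisation Φ₁ T ιT θT) (hB : IsCMTypeRealisation Φ₃ B ιB θB)
    {τ : k →+* ℂ} (hτΨ : τ ∈ Ψ.1)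
    (h12 : (Finset.univ.filter fun s : K₁ →+* ℂ => s.comp i₁ = τ ∧ s ∈ Φ₁.1).card = 1 ∨
      (Finset.univ.filter fun s : K₁ →+* ℂ => s.comp i₁ = τ ∧ s ∈ Φ₁.1).card = 2)
    (h23 : (Finset.univ.filter fun t : K₃ →+* ℂ => t.comp i₃ = τ ∧ t ∈ Φ₃.1).card = 2 ∨
      (Finset.univ.filter fun t : K₃ →+* ℂ => t.comp i₃ = τ ∧ t ∈ Φ₃.1).card = 3) (κ : Fin N → Fin 3) :
    HodgeConjectureFor (⨁ fun j => (![E, T, B] : Fin 3 → AbelianVariety ℂ) (κ j)).dim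
      (⨁ fun j => (![E, T, B] : Fin 3 → AbelianVariety ℂ) (κ j)).X := by
  have hn₁ := card_filter_comp_eq_of_finrank (n := 3) i₁ h6 h2 τ
  have hn₃ := card_filter_comp_eq_of_finrank (n := 5) i₃ h10 h2 τ
  -- normalise `T` to one member over `τ`
  have hT' : ∃ (Φ₁' : CMType K₁) (ιT' : 𝓞 K₁ →+* End T) (θT' : K₁ →+* Module.End ℂ (complexBetti T.X 1)),
      IsCMTypeRealisation Φ₁' T ιT' θT' ∧ (Finset.univ.filter fun s : K₁ →+* ℂ => s.comp i₁ = τ ∧ s ∈ Φ₁'.1).card = 1 := by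
    rcases h12 with h | h
    · exact ⟨Φ₁, ιT, θT, hT, h⟩
    · refine ⟨_, _, _, hT.transport (IsCMField.complexConj K₁).toRingEquiv, ?_⟩
      rw [card_filter_cmTypeMap_complexConj i₁ τ Φ₁, hn₁, h]
  -- normalise `B` to two members over `τ`
  have hB' : ∃ (Φ₃' : CMType K₃) (ιB' : 𝓞 K₃ →+* End B) (θB' : K₃ →+* Module.End ℂ (complexBetti B.X 1)),
      IsCMTypeRealisation Φ₃' B ιB' θB' ∧ (Finset.univ.filter fun t : K₃ →+* ℂ => t.comp i₃ = τ ∧ t ∈ Φ₃'.1).card = 2 := by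
    rcases h23 with h | h
    · exact ⟨Φ₃, ιB, θB, hB, h⟩
    · refine ⟨_, _, _, hB.transport (IsCMField.complexConj K₃).toRingEquiv, ?_⟩
      rw [card_filter_cmTypeMap_complexConj i₃ τ Φ₃, hn₃, h]
  obtain ⟨Φ₁', ιT', θT', hT'', h12'⟩ := hT'
  obtain ⟨Φ₃', ιB', θB', hB'', h23'⟩ := hB'
  exact hodgeConjectureFor_biproduct_comp_vec_of_markman hW4 hM6 h2 h6 h10 i₁ i₃ hE hT'' hB'' hτΨ h12' h23' κ

/-- **Everything dominated, all four sign combinations.** [cite: Markman2025SurveySecant, Thm. 1.2] [cite: Markman2025SecantWeil, Thm 1.5.1]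
[cite: MumfordAV1970, §19] -/
theorem hodgeConjectureFor_of_avDominatedBy_comp_vec_of_markman_of_signs
    (hW4 : Markman2025_weilClasses_algebraic_abelianFourfold) (hM6 : Markman2025_weilClasses_algebraic_hyperbolicSixfold)
    (h2 : Module.finrank ℚ k = 2) (h6 : Module.finrank ℚ K₁ = 6) (h10 : Module.finrank ℚ K₃ = 10) (i₁ : k →+* K₁) (i₃ : k →+* K₃)
    (hE : IsCMTypeRealisation Ψ E ιE θE) (hT : IsCMTypeRealisation Φ₁ T ιT θT) (hB : IsCMTypeRealisation Φ₃ B ιB θB)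
    {τ : k →+* ℂ} (hτΨ : τ ∈ Ψ.1)
    (h12 : (Finset.univ.filter fun s : K₁ →+* ℂ => s.comp i₁ = τ ∧ s ∈ Φ₁.1).card = 1 ∨
      (Finset.univ.filter fun s : K₁ →+* ℂ => s.comp i₁ = τ ∧ s ∈ Φ₁.1).card = 2)
    (h23 : (Finset.univ.filter fun t : K₃ →+* ℂ => t.comp i₃ = τ ∧ t ∈ Φ₃.1).card = 2 ∨
      (Finset.univ.filter fun t : K₃ →+* ℂ => t.comp i₃ = τ ∧ t ∈ Φ₃.1).card = 3) (κ : Fin N → Fin 3)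
    {X : AbelianVariety ℂ} (hX : Domination.AVDominatedBy X (⨁ fun j => (![E, T, B] : Fin 3 → AbelianVariety ℂ) (κ j))) :
    HodgeConjectureFor X.dim X.X :=
  Domination.hodgeConjectureFor_of_avDominatedBy
    (hodgeConjectureFor_biproduct_comp_vec_of_markman_of_signs hW4 hM6 h2 h6 h10 i₁ i₃ hE hT hB hτΨ h12 h23 κ) hX

end Signatures

/-! ## §4 Families: every finite family of realisations of the two types -/

section Family

variable {k K₁ K₃ : Type} [Field k] [NumberField k] [IsCMField k] [Field K₁] [NumberField K₁] [IsCMField K₁]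
  [Field K₃] [NumberField K₃] [IsCMField K₃] {N₁ N₃ : ℕ}
  {E T B : AbelianVariety ℂ} {Ψ : CMType k} {Φ₁ : CMType K₁} {Φ₃ : CMType K₃}
  {ιE : 𝓞 k →+* End E} {θE : k →+* Module.End ℂ (complexBetti E.X 1)}
  {ιT : 𝓞 K₁ →+* End T} {θT : K₁ →+* Module.End ℂ (complexBetti T.X 1)}
  {ιB : 𝓞 K₃ →+* End B} {θB : K₃ →+* Module.End ℂ (complexBetti B.X 1)}
  {Tf : Fin N₁ → AbelianVariety ℂ} {ιTf : ∀ j, 𝓞 K₁ →+* End (Tf j)} {θTf : ∀ j, K₁ →+* Module.End ℂ (complexBetti (Tf j).X 1)}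
  {Bf : Fin N₃ → AbelianVariety ℂ} {ιBf : ∀ l, 𝓞 K₃ →+* End (Bf l)} {θBf : ∀ l, K₃ →+* Module.End ℂ (complexBetti (Bf l).X 1)}

/-- **FAMILIES.  The Hodge conjecture for every abelian variety dominated by `E^a × ∏_j T_j × ∏_l B_l`**, where the `T_j ⊨ (K₁; Φ₁)` are ANY
realisations of the `(1,2)`-type `Φ₁` and the `B_l ⊨ (K₃; Φ₃)` ANY realisations of the `(2,3)`-type `Φ₃` (two realisations of one CM type are
isogenous — `DecicWeil23Pair.avDominatedBy_of_cmType_eq`, Shimura — so the product is dominated by `E^a × T^{N₁} × B^{N₃}` for the anchors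
`T`, `B`), GIVEN ONLY Markman's two theorems; no hypothesis on the fields. [cite: Markman2025SurveySecant, Thm. 1.2]
[cite: Markman2025SecantWeil, Thm 1.5.1] [cite: Shimura1998, §6.2 Thm. 3] [cite: MumfordAV1970, §19] -/
theorem hodgeConjectureFor_of_avDominatedBy_families_of_markman
    (hW4 : Markman2025_weilClasses_algebraic_abelianFourfold) (hM6 : Markman2025_weilClasses_algebraic_hyperbolicSixfold)
    (h2 : Module.finrank ℚ k = 2) (h6 : Module.finrank ℚ K₁ = 6) (h10 : Module.finrank ℚ K₃ = 10) (i₁ : k →+* K₁) (i₃ : k →+* K₃)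
    (hE : IsCMTypeRealisation Ψ E ιE θE) (hT : IsCMTypeRealisation Φ₁ T ιT θT) (hB : IsCMTypeRealisation Φ₃ B ιB θB)
    {τ : k →+* ℂ} (hτΨ : τ ∈ Ψ.1)
    (h12 : (Finset.univ.filter fun s : K₁ →+* ℂ => s.comp i₁ = τ ∧ s ∈ Φ₁.1).card = 1)
    (h23 : (Finset.univ.filter fun t : K₃ →+* ℂ => t.comp i₃ = τ ∧ t ∈ Φ₃.1).card = 2)
    (hTf : ∀ j, IsCMTypeRealisation Φ₁ (Tf j) (ιTf j) (θTf j)) (hBf : ∀ l, IsCMTypeRealisation Φ₃ (Bf l) (ιBf l) (θBf l)) (a : ℕ)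
    {C : AbelianVariety ℂ} (hC : AVDominatedBy C ((⨁ fun _ : Fin a => E).prod ((⨁ Tf).prod (⨁ Bf)))) :
    HodgeConjectureFor C.dim C.X := by
  let Y : Fin 3 → AbelianVariety ℂ := ![E, T, B]
  have h₀ : AVDominatedBy (⨁ fun _ : Fin a => E) (⨁ fun _ : Fin a => Y 0) :=
    AVDominatedBy.biproduct_map fun _ => AVDominatedBy.refl E
  have h₁ : AVDominatedBy (⨁ Tf) (⨁ fun _ : Fin N₁ => Y 1) :=
    AVDominatedBy.biproduct_map fun j => avDominatedBy_of_cmType_eq rfl (hTf j) hT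
  have h₃ : AVDominatedBy (⨁ Bf) (⨁ fun _ : Fin N₃ => Y 2) :=
    AVDominatedBy.biproduct_map fun l => avDominatedBy_of_cmType_eq rfl (hBf l) hB
  have h := avDominatedBy_prod_of_biproduct h₀ (avDominatedBy_prod_of_biproduct h₁ h₃)
  let κ' : Fin a ⊕ (Fin N₁ ⊕ Fin N₃) → Fin 3 := Sum.elim (fun _ => 0) (Sum.elim (fun _ => 1) fun _ => 2)
  have hfam : sumFam (fun _ : Fin a => Y 0) (sumFam (fun _ : Fin N₁ => Y 1) (fun _ : Fin N₃ => Y 2)) = Y ∘ κ' :=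
    funext fun x => by rcases x with x | x | x <;> rfl
  rw [hfam] at h
  let eqv : Fin (a + (N₁ + N₃)) ≃ Fin a ⊕ (Fin N₁ ⊕ Fin N₃) :=
    finSumFinEquiv.symm.trans (Equiv.sumCongr (Equiv.refl _) finSumFinEquiv.symm)
  have hdom := avDominatedBy_biproduct_reindex eqv h
  exact Domination.hodgeConjectureFor_of_avDominatedBy
    (hodgeConjectureFor_biproduct_comp_vec_of_markman hW4 hM6 h2 h6 h10 i₁ i₃ hE hT hB hτΨ h12 h23 (κ' ∘ eqv)) (hC.trans hdom)

/-- **In particular: the Hodge conjecture for `∏_j T_j × ∏_l B_l` itself** (any finite families of realisations of the two types).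
[cite: Markman2025SurveySecant, Thm. 1.2] [cite: Markman2025SecantWeil, Thm 1.5.1] [cite: MumfordAV1970, §19] -/
theorem hodgeConjectureFor_biproduct_families_of_markman
    (hW4 : Markman2025_weilClasses_algebraic_abelianFourfold) (hM6 : Markman2025_weilClasses_algebraic_hyperbolicSixfold)
    (h2 : Module.finrank ℚ k = 2) (h6 : Module.finrank ℚ K₁ = 6) (h10 : Module.finrank ℚ K₃ = 10) (i₁ : k →+* K₁) (i₃ : k →+* K₃)
    (hE : IsCMTypeRealisation Ψ E ιE θE) (hT : IsCMTypeRealisation Φ₁ T ιT θT) (hB : IsCMTypeRealisation Φ₃ B ιB θB)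
    {τ : k →+* ℂ} (hτΨ : τ ∈ Ψ.1)
    (h12 : (Finset.univ.filter fun s : K₁ →+* ℂ => s.comp i₁ = τ ∧ s ∈ Φ₁.1).card = 1)
    (h23 : (Finset.univ.filter fun t : K₃ →+* ℂ => t.comp i₃ = τ ∧ t ∈ Φ₃.1).card = 2)
    (hTf : ∀ j, IsCMTypeRealisation Φ₁ (Tf j) (ιTf j) (θTf j)) (hBf : ∀ l, IsCMTypeRealisation Φ₃ (Bf l) (ιBf l) (θBf l)) :
    HodgeConjectureFor ((⨁ Tf).prod (⨁ Bf)).dim ((⨁ Tf).prod (⨁ Bf)).X :=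
  hodgeConjectureFor_of_avDominatedBy_families_of_markman hW4 hM6 h2 h6 h10 i₁ i₃ hE hT hB hτΨ h12 h23 hTf hBf 0
    (C := (⨁ Tf).prod (⨁ Bf)) ⟨AbelianVariety.prodLift 0 (𝟙 _), AbelianVariety.snd _ _, 1, one_ne_zero, by
      rw [AbelianVariety.prodLift_snd, one_smul]⟩

end Family

end Summit.HodgeConjecture.CorCM.SexticDecicWeil

end
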